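import Literature.NumberTheory.EllipticCurves.DeligneSerreWeightOneIrreducibleFrobeniusProofs
import Literature.NumberTheory.NumberFields.SplitPrimesDisjointnessAbsolute
import HarnessLib

/-!
# An arithmetic Frobenius of `Γ_K` above a completely split prime fixes the subfield

Topic `Literature/NumberTheory/GaloisRepresentations` (vocabulary of `IntegralGaloisAction.lean`:
`absIntegers (𝓞 K) K = \bar ℤ_K`, the primes `𝔓 ∈ v.primesAbove` of `\bar ℤ_K` above a finite place
`v` of the number field `K`, `IsArithFrobAt (𝓞 K) Φ 𝔓` for `Φ : absoluteGaloisGroup K = Gal(K̄/K)`;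
and of `FrobeniusDensityTheorem.lean`: `splitPrimes K E`, the primes of `K` splitting completely in
`E`).  Theorem-only file (no definition, no named fact, D-0026).

Let `E ⊆ K̄` be a finite Galois subextension of `K`, `v` a prime of `K` that **splits completely**
in `E`, `𝔓` a prime of `\bar ℤ_K` above `v`, and `Φ ∈ Γ_K` an arithmetic Frobenius at `𝔓`.

* `restrictNormalHom_eq_one_of_mem_splitPrimes` — **`Φ|_E = 1`** (the tree's
  `isArithFrobAt_restrictHom`: `Φ|_E` is an arithmetic Frobenius of `E/K` at `𝔓 ∩ 𝓞 E`,
  Neukirch Ch. I §9 (9.4)–(9.5); then the finite-level dictionary);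
  `smul_eq_self_of_mem_splitPrimes` — `Φ • x = x` for all `x ∈ E`;
  `mem_fixingSubgroup_of_mem_splitPrimes` — `Φ ∈ Gal(K̄/E)`;
* `smul_algHom_eq_self_of_mem_splitPrimes` — the same for an abstract finite Galois `E/K` and
  any `K`-embedding `e : E → K̄`: `Φ • e x = e x`.

This is the absolute (`Γ_K`) form of Marcus, *Number Fields*, Ch. 4 (after Thm. 32): *"an
unramified prime `P` splits completely in the normal extension `L` iff `φ = 1`"* — the
decomposition groups above a completely split prime are trivial — combined with the restriction
of Frobenius elements from `Γ_K` to `Gal(E/K)`.  The finite-level statement is the tree's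
`mem_splitPrimes_intermediateField_iff` / `mem_fixingSubgroup_of_inertiaDeg_under_eq_one`
(`FrobeniusDensityTheorem.lean`), and the passage `Γ_K → Gal(E/K)` is the tree's
`comap_ringOfIntegersToIntegralClosure_mem_primesOver` / `isArithFrobAt_restrictHom` /
`absoluteGaloisGroup.restrictNormalHom_eq_one_iff`
(`EllipticCurves/DeligneSerreWeightOneIrreducibleFrobeniusProofs.lean`, reused, not redeclared);
this file only assembles them at a completely split prime.  Consumer: the Kolyvagin-system bookkeeping "`λ = (ℓ)` splits completely in
the ring class field `K_n`, hence every Frobenius at a prime above `λ` fixes the `K_n`-rational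
Heegner point" (Gross 1991 §3; `EllipticCurves/RingClassFieldSplitting.lean`).

## References

* D. A. Marcus, *Number Fields*, 2nd ed. (2018), Ch. 4, Thm. 28–29 and the remark after Thm. 32
  ("an unramified prime `P` splits completely in the normal extension `L` iff `φ = 1`").
  [Marcus2018]
* J. Neukirch, *Algebraic Number Theory* (1999), Ch. I §9, (9.3)–(9.5) (decomposition group,
  Frobenius automorphism, behaviour in towers). [NeukirchANT1999]
-/

noncomputable section

open scoped NumberField Pointwise
open NumberField IsDedekindDomain Field

namespace Literature.NumberTheory.GaloisRepresentations

/-! ### Complete splitting: the restriction is trivial -/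

variable {K : Type*} [Field K] [NumberField K]

/-- **An arithmetic Frobenius above a completely split prime restricts trivially**: if `v` splits
completely in the finite Galois subextension `E ⊆ K̄` of `K`, `𝔓 ∣ v` is a prime of `\bar ℤ_K` and
`Φ ∈ Γ_K` is an arithmetic Frobenius at `𝔓`, then `Φ|_E = 1` in `Gal(E/K)` (Marcus Ch. 4: *"an
unramified prime `P` splits completely in the normal extension `L` iff `φ = 1`"*, applied to the
Frobenius `Φ|_E` of `E/K` at `𝔓 ∩ 𝓞 E`).
[cite: Marcus2018, Ch. 4, remark after Thm. 32] [cite: NeukirchANT1999, Ch. I §9, (9.4)–(9.5)] -/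
theorem restrictNormalHom_eq_one_of_mem_splitPrimes (E : IntermediateField K (AlgebraicClosure K))
    [FiniteDimensional K E] [IsGalois K E] {v : HeightOneSpectrum (𝓞 K)} (hv : v ∈ splitPrimes K E)
    {𝔓 : Ideal (absIntegers (𝓞 K) K)} (h𝔓 : 𝔓 ∈ v.primesAbove) {Φ : absoluteGaloisGroup K}
    (hΦ : IsArithFrobAt (𝓞 K) Φ 𝔓) :
    AlgEquiv.restrictNormalHom E (absoluteGaloisGroup.toAlgEquiv K Φ) = 1 := by
  classical
  haveI : NumberField E := NumberField.of_module_finite K E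
  have hQv := comap_ringOfIntegersToIntegralClosure_mem_primesOver E h𝔓
  have hσ := isArithFrobAt_restrictHom E h𝔓 hΦ
  -- pass to the top intermediate field of `E/K`, where the finite-level dictionary applies
  haveI : IsGalois K (⊤ : IntermediateField K E) :=
    IsGalois.of_algEquiv IntermediateField.topEquiv.symm
  have hvT : v ∈ splitPrimes K (⊤ : IntermediateField K E) := by
    rw [NumberFields.splitPrimes_congr (IntermediateField.topEquiv (F := K) (E := E))]
    exact hv
  have key := (mem_splitPrimes_intermediateField_iff (⊤ : IntermediateField K E) hv.1 hvT.1 hQv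
    hσ).mp hvT
  rwa [IntermediateField.fixingSubgroup_top, Subgroup.mem_bot] at key

/-- **An arithmetic Frobenius above a completely split prime fixes `E` pointwise**: with the
hypotheses of `restrictNormalHom_eq_one_of_mem_splitPrimes`, `Φ • x = x` for every `x ∈ E ⊆ K̄`.
[cite: Marcus2018, Ch. 4, remark after Thm. 32] [cite: NeukirchANT1999, Ch. I §9, (9.4)–(9.5)] -/
theorem smul_eq_self_of_mem_splitPrimes (E : IntermediateField K (AlgebraicClosure K))
    [FiniteDimensional K E] [IsGalois K E] {v : HeightOneSpectrum (𝓞 K)} (hv : v ∈ splitPrimes K E)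
    {𝔓 : Ideal (absIntegers (𝓞 K) K)} (h𝔓 : 𝔓 ∈ v.primesAbove) {Φ : absoluteGaloisGroup K}
    (hΦ : IsArithFrobAt (𝓞 K) Φ 𝔓) {x : AlgebraicClosure K} (hx : x ∈ E) :
    Φ • x = x := by
  have h1 := restrictNormalHom_eq_one_of_mem_splitPrimes E hv h𝔓 hΦ
  have h2 := AlgEquiv.restrictNormalHom_apply E (absoluteGaloisGroup.toAlgEquiv K Φ) ⟨x, hx⟩
  rw [h1, AlgEquiv.one_apply] at h2
  rw [absoluteGaloisGroup.smul_def]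
  exact h2.symm

/-- **`Φ ∈ Gal(K̄/E)`**: an arithmetic Frobenius of `Γ_K` above a prime splitting completely in
the finite Galois `E ⊆ K̄` lies in the fixing subgroup of `E`.
[cite: Marcus2018, Ch. 4, remark after Thm. 32] [cite: NeukirchANT1999, Ch. I §9, (9.4)–(9.5)] -/
theorem mem_fixingSubgroup_of_mem_splitPrimes (E : IntermediateField K (AlgebraicClosure K))
    [FiniteDimensional K E] [IsGalois K E] {v : HeightOneSpectrum (𝓞 K)} (hv : v ∈ splitPrimes K E)
    {𝔓 : Ideal (absIntegers (𝓞 K) K)} (h𝔓 : 𝔓 ∈ v.primesAbove) {Φ : absoluteGaloisGroup K}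
    (hΦ : IsArithFrobAt (𝓞 K) Φ 𝔓) :
    Φ ∈ (E.fixingSubgroup : Subgroup (absoluteGaloisGroup K)) :=
  (absoluteGaloisGroup.restrictNormalHom_eq_one_iff E Φ).mp
    (restrictNormalHom_eq_one_of_mem_splitPrimes E hv h𝔓 hΦ)

/-! ### Embedded form: an abstract finite Galois `E/K` with a `K`-embedding into `K̄` -/

/-- **Embedded form.**  Let `E/K` be finite Galois, `e : E → K̄` a `K`-embedding, `v` a prime of `K`
splitting completely in `E`, `𝔓 ∣ v` a prime of `\bar ℤ_K` and `Φ ∈ Γ_K` an arithmetic Frobenius at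
`𝔓`.  Then `Φ • e x = e x` for every `x ∈ E` (apply `smul_eq_self_of_mem_splitPrimes` to the image
`e(E) ⊆ K̄`, which is `K`-isomorphic to `E`, so that `v` splits completely in it).
[cite: Marcus2018, Ch. 4, remark after Thm. 32] [cite: NeukirchANT1999, Ch. I §9, (9.4)–(9.5)] -/
theorem smul_algHom_eq_self_of_mem_splitPrimes {E : Type*} [Field E] [NumberField E] [Algebra K E]
    [IsGalois K E] (e : E →ₐ[K] AlgebraicClosure K) {v : HeightOneSpectrum (𝓞 K)}
    (hv : v ∈ splitPrimes K E) {𝔓 : Ideal (absIntegers (𝓞 K) K)} (h𝔓 : 𝔓 ∈ v.primesAbove)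
    {Φ : absoluteGaloisGroup K} (hΦ : IsArithFrobAt (𝓞 K) Φ 𝔓) (x : E) :
    Φ • e x = e x := by
  set ε : E ≃ₐ[K] e.fieldRange :=
    (show E ≃ₐ[K] e.fieldRange from AlgEquiv.ofInjectiveField e) with hεdef
  haveI : FiniteDimensional K e.fieldRange := LinearEquiv.finiteDimensional ε.toLinearEquiv
  haveI : IsGalois K e.fieldRange := IsGalois.of_algEquiv ε
  haveI : NumberField e.fieldRange := NumberField.of_module_finite K e.fieldRange
  have hv' : v ∈ splitPrimes K e.fieldRange := by
    rw [← NumberFields.splitPrimes_congr ε]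
    exact hv
  have hx : e x ∈ e.fieldRange := ⟨x, rfl⟩
  exact smul_eq_self_of_mem_splitPrimes e.fieldRange hv' h𝔓 hΦ hx

end Literature.NumberTheory.GaloisRepresentations

end
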